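import Literature.NumberTheory.Sieve.BatemanHornMertensProduct
import HarnessLib

/-!
# The sieve product of a Bateman–Horn system with staggered thresholds

Topic `Literature/NumberTheory/Sieve`, continuation of `BatemanHornMertensProduct.lean`.  For a
Bateman–Horn system `f = (f₁, …, f_k)` (`IsBatemanHornSystem f`) and real thresholds `zᵢ`, the sieve
that removes, for every prime `p`, the classes `r mod p` with `p ∣ fᵢ(r)` for some `i` with
`p < zᵢ` has the density product
`V = ∏_{p ≤ x} (1 − ω(p)/p)`, `ω(p) = #{r mod p : ∃ i, p < zᵢ ∧ p ∣ fᵢ(r)}`.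
Writing `mᵢ = ⌈zᵢ⌉₊ − 1` (the primes `≤ mᵢ` are the primes `< zᵢ`) and `i₀` for an index with the
least threshold, we PROVE (sub-namespace `BatemanHornMertens`):

* `prod_one_sub_card_div_eq` — the exact decomposition
  `V = [∏_{p ≤ m_{i₀}} (1 − ω_f(p)/p)] · ∏ᵢ [Pᵢ(mᵢ)/Pᵢ(m_{i₀})] · E`,
  `Pᵢ(n) = ∏_{p ≤ n} (1 − ρᵢ(p)/p)`, where `E` is the product over the primes `m_{i₀} < p ≤ x` of
  the correction factors `c_p = (1 − ω(p)/p) / ∏_{i : p < zᵢ} (1 − ρᵢ(p)/p)`;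
* `corr_prod_bounds` — if `ω_f(p) = ∑ᵢ ρᵢ(p)` for the primes `p > m₀` (all large `p`,
  `IsBatemanHornSystem.exists_polyRootCountMod_eq_sum`), then
  `1 − 4(∑ deg fᵢ)²/(m₀ + 1) ≤ E ≤ 1` (`c_p = 1 + O((∑ deg fᵢ)²/p²)` by the Weierstrass
  inequalities, and `∑_{p > m₀} p⁻² ≤ 2/(m₀ + 1)`).

Together with Mertens' theorem along `f` and along each `fᵢ` (`BatemanHornMertensProduct.lean`)
this gives the asymptotic `V (log x)^k → C(f) e^{−kγ} U^k/∏ deg fᵢ` for `zᵢ = x^{deg fᵢ/U}`.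

## References

* P. T. Bateman, R. A. Horn, Math. Comp. 16 (1962), 363–367, §2.
* H. Halberstam, H.-E. Richert, *Sieve Methods* (1974), §5 (sieve products of polynomial
  sequences).
-/

noncomputable section

open Filter Finset Polynomial
open scoped Topology

namespace Literature.NumberTheory.Sieve

namespace BatemanHornMertens

variable {ι : Type*}

/-- The primes in the window `(m_{i₀}, x]` below the threshold `zᵢ ≤ x` are the primes `≤ mᵢ` that
are not `≤ m_{i₀}` (`m = ⌈z⌉₊ − 1`). [folklore] -/
theorem filter_lt_primesLE_sdiff (z : ι → ℝ) (i₀ i : ι) {x : ℕ} (hzx : z i ≤ x) :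
    (Nat.primesLE x \ Nat.primesLE (⌈z i₀⌉₊ - 1)).filter (fun p : ℕ => (p : ℝ) < z i) =
      Nat.primesLE (⌈z i⌉₊ - 1) \ Nat.primesLE (⌈z i₀⌉₊ - 1) := by
  ext p
  simp only [mem_filter, Finset.mem_sdiff, mem_primesLE_ceil_sub_one]
  rw [Nat.mem_primesLE]
  constructor
  · rintro ⟨⟨⟨-, hp⟩, hnot⟩, hpz⟩
    exact ⟨⟨hp, hpz⟩, hnot⟩
  · rintro ⟨⟨hp, hpz⟩, hnot⟩
    refine ⟨⟨⟨?_, hp⟩, hnot⟩, hpz⟩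
    exact_mod_cast (hpz.trans_le hzx).le

/-- **Products of factors `1 + O(p⁻²)` over a window of integers.**  If `0 ≤ c_p ≤ 1` and
`1 − c_p ≤ B/p²` for the `p` in a set `W ⊆ (m₀, n)`, then `1 − 2B/(m₀ + 1) ≤ ∏_{p ∈ W} c_p ≤ 1`
(Weierstrass' inequality and `∑_{p > m₀} p⁻² ≤ 2/(m₀ + 1)`). [folklore] -/
theorem prod_bounds_of_factor_bounds {W : Finset ℕ} {m₀ n : ℕ} (hW : W ⊆ Ioo m₀ n) (c : ℕ → ℝ)
    {B : ℝ} (hB : 0 ≤ B)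
    (hc : ∀ p ∈ W, 0 ≤ c p ∧ 0 ≤ 1 - c p ∧ 1 - c p ≤ B * ((p : ℝ) ^ 2)⁻¹) :
    1 - 2 * B / ((m₀ : ℝ) + 1) ≤ ∏ p ∈ W, c p ∧ ∏ p ∈ W, c p ≤ 1 := by
  have htail : ∑ p ∈ W, (1 - c p) ≤ 2 * B / ((m₀ : ℝ) + 1) := by
    calc ∑ p ∈ W, (1 - c p) ≤ ∑ p ∈ W, B * ((p : ℝ) ^ 2)⁻¹ := sum_le_sum fun p hp => (hc p hp).2.2
      _ = B * ∑ p ∈ W, ((p : ℝ) ^ 2)⁻¹ := by rw [mul_sum]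
      _ ≤ B * (2 / ((m₀ : ℝ) + 1)) := by
          refine mul_le_mul_of_nonneg_left ?_ hB
          calc ∑ p ∈ W, ((p : ℝ) ^ 2)⁻¹ ≤ ∑ p ∈ Ioo m₀ n, ((p : ℝ) ^ 2)⁻¹ :=
                sum_le_sum_of_subset_of_nonneg hW fun p _ _ => by positivity
            _ ≤ 2 / ((m₀ : ℝ) + 1) := sum_Ioo_inv_sq_le m₀ n
      _ = 2 * B / ((m₀ : ℝ) + 1) := by ring
  constructor
  · calc 1 - 2 * B / ((m₀ : ℝ) + 1) ≤ 1 - ∑ p ∈ W, (1 - c p) := by linarith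
      _ ≤ ∏ p ∈ W, (1 - (1 - c p)) :=
          CFZ.one_sub_sum_le_prod_one_sub _ (fun p hp => (hc p hp).2.1)
            fun p hp => by linarith [(hc p hp).1]
      _ = ∏ p ∈ W, c p := by simp only [sub_sub_cancel]
  · exact prod_le_one (fun p hp => (hc p hp).1) fun p hp => by linarith [(hc p hp).2.1]

variable [Fintype ι]

/-- **The correction factor at one prime.**  If `ρᵢ < p`, `ρᵢ ≤ dᵢ` and `ω = ∑_{i ∈ T} ρᵢ ≤ p`, then
`c = (1 − ω/p)/∏_{i ∈ T}(1 − ρᵢ/p)` satisfies `0 ≤ c ≤ 1` and `1 − c ≤ 2(∑ᵢ dᵢ)²/p²`.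
[folklore] -/
theorem corr_factor_bounds {p : ℕ} (hp0 : 0 < p) (T : Finset ι) (ρ d : ι → ℕ)
    (hρp : ∀ i ∈ T, ρ i < p) (hρd : ∀ i, ρ i ≤ d i) {ω : ℕ} (hω : ω = ∑ i ∈ T, ρ i)
    (hωp : ω ≤ p) :
    0 ≤ (1 - (ω : ℝ) / p) / ∏ i ∈ T, (1 - (ρ i : ℝ) / p) ∧
    0 ≤ 1 - (1 - (ω : ℝ) / p) / ∏ i ∈ T, (1 - (ρ i : ℝ) / p) ∧
    1 - (1 - (ω : ℝ) / p) / ∏ i ∈ T, (1 - (ρ i : ℝ) / p) ≤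
      2 * ((∑ i, d i : ℕ) : ℝ) ^ 2 * ((p : ℝ) ^ 2)⁻¹ := by
  have hp : (0 : ℝ) < p := by exact_mod_cast hp0
  have h0 : ∀ i ∈ T, 0 ≤ (ρ i : ℝ) / p := fun i _ => by positivity
  have h1 : ∀ i ∈ T, (ρ i : ℝ) / p < 1 := fun i hi => by
    rw [div_lt_one hp]
    exact_mod_cast hρp i hi
  have hs_eq : (ω : ℝ) / p = ∑ i ∈ T, (ρ i : ℝ) / p := by
    rw [hω, Nat.cast_sum, sum_div]
  have hs1 : ∑ i ∈ T, (ρ i : ℝ) / p ≤ 1 := by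
    rw [← hs_eq, div_le_one hp]
    exact_mod_cast hωp
  have hs0 : 0 ≤ ∑ i ∈ T, (ρ i : ℝ) / p := sum_nonneg h0
  have hsD : ∑ i ∈ T, (ρ i : ℝ) / p ≤ ((∑ i, d i : ℕ) : ℝ) / p := by
    rw [← sum_div]
    refine div_le_div_of_nonneg_right ?_ hp.le
    calc ∑ i ∈ T, (ρ i : ℝ) ≤ ∑ i, (ρ i : ℝ) :=
          sum_le_sum_of_subset_of_nonneg (subset_univ _) fun i _ _ => by positivity
      _ ≤ ∑ i, (d i : ℝ) := sum_le_sum fun i _ => by exact_mod_cast hρd i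
      _ = ((∑ i, d i : ℕ) : ℝ) := by push_cast; rfl
  obtain ⟨hlo, hhi⟩ := one_sub_div_prod_bounds T h0 h1 hs1
  rw [← hs_eq] at hlo hhi
  refine ⟨div_nonneg ?_ (prod_pos fun i hi => sub_pos.mpr (h1 i hi)).le, hlo, hhi.trans ?_⟩
  · rw [sub_nonneg, div_le_one hp]
    exact_mod_cast hωp
  · rw [hs_eq]
    calc 2 * (∑ i ∈ T, (ρ i : ℝ) / p) ^ 2 ≤ 2 * (((∑ i, d i : ℕ) : ℝ) / p) ^ 2 :=
          mul_le_mul_of_nonneg_left (pow_le_pow_left₀ hs0 hsD 2) (by norm_num)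
      _ = 2 * ((∑ i, d i : ℕ) : ℝ) ^ 2 * ((p : ℝ) ^ 2)⁻¹ := by
          rw [div_pow]; ring

/-- Every factor `1 − ρᵢ(p)/p` (`p` prime) of the single-polynomial sieve product is positive.
[folklore] -/
theorem one_sub_rootCount_single_div_pos {f : ι → ℤ[X]} (hf : IsBatemanHornSystem f) (i : ι)
    {p : ℕ} (hp : p.Prime) : 0 < 1 - (polyRootCountMod ![f i] p : ℝ) / p := by
  have hp0 : (0 : ℝ) < p := by exact_mod_cast hp.pos
  rw [sub_pos, div_lt_one hp0]
  exact_mod_cast rootCount_single_lt hf i hp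

/-- **Exact decomposition of the staggered sieve product.**  For thresholds `zᵢ ≤ x` with least
member `z_{i₀}`:
`∏_{p ≤ x} (1 − ω(p)/p) =
  [∏_{p ≤ m_{i₀}} (1 − ω_f(p)/p)] · ∏ᵢ [Pᵢ(mᵢ)/Pᵢ(m_{i₀})] · ∏_{m_{i₀} < p ≤ x} c_p`
(`mᵢ = ⌈zᵢ⌉₊ − 1`; below `z_{i₀}` every coordinate is sifted, so `ω(p) = ω_f(p)`; on the window
`1 − ω(p)/p = c_p · ∏_{i : p < zᵢ} (1 − ρᵢ(p)/p)` by definition of `c_p`, and the double product is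
re-indexed by `i`). [folklore] -/
theorem prod_one_sub_card_div_eq {k : ℕ} {f : Fin k → ℤ[X]} (hf : IsBatemanHornSystem f)
    (z : Fin k → ℝ) (i₀ : Fin k) (hz₀ : ∀ i, z i₀ ≤ z i) {x : ℕ} (hzx : ∀ i, z i ≤ x) :
    ∏ p ∈ Nat.primesBelow (x + 1),
        (1 - (((range p).filter (fun r : ℕ => ∃ i,
          (p : ℝ) < z i ∧ (p : ℤ) ∣ (f i).eval (r : ℤ))).card : ℝ) / (p : ℝ)) =
      (∏ p ∈ Nat.primesLE (⌈z i₀⌉₊ - 1), (1 - (polyRootCountMod f p : ℝ) / p)) *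
      (∏ i, (∏ p ∈ Nat.primesLE (⌈z i⌉₊ - 1), (1 - (polyRootCountMod ![f i] p : ℝ) / p)) /
          ∏ p ∈ Nat.primesLE (⌈z i₀⌉₊ - 1), (1 - (polyRootCountMod ![f i] p : ℝ) / p)) *
      ∏ p ∈ Nat.primesLE x \ Nat.primesLE (⌈z i₀⌉₊ - 1),
        ((1 - (((range p).filter (fun r : ℕ => ∃ i,
            (p : ℝ) < z i ∧ (p : ℤ) ∣ (f i).eval (r : ℤ))).card : ℝ) / (p : ℝ)) /
          ∏ i ∈ univ.filter (fun i => (p : ℝ) < z i),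
            (1 - (polyRootCountMod ![f i] p : ℝ) / p)) := by
  have hm₀x : ⌈z i₀⌉₊ - 1 ≤ x := by
    have h := Nat.ceil_mono (hzx i₀)
    rw [Nat.ceil_natCast] at h
    omega
  have hsub : Nat.primesLE (⌈z i₀⌉₊ - 1) ⊆ Nat.primesLE x := Nat.primesLE_mono hm₀x
  have hsubi : ∀ i, Nat.primesLE (⌈z i₀⌉₊ - 1) ⊆ Nat.primesLE (⌈z i⌉₊ - 1) := fun i =>
    Nat.primesLE_mono (Nat.sub_le_sub_right (Nat.ceil_mono (hz₀ i)) 1)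
  rw [show Nat.primesBelow (x + 1) = Nat.primesLE x from rfl, ← prod_sdiff hsub]
  -- the small primes: every coordinate is sifted
  have hsmall : ∏ p ∈ Nat.primesLE (⌈z i₀⌉₊ - 1),
      (1 - (((range p).filter (fun r : ℕ => ∃ i,
          (p : ℝ) < z i ∧ (p : ℤ) ∣ (f i).eval (r : ℤ))).card : ℝ) / (p : ℝ)) =
      ∏ p ∈ Nat.primesLE (⌈z i₀⌉₊ - 1), (1 - (polyRootCountMod f p : ℝ) / p) := by
    refine prod_congr rfl fun p hp => ?_
    obtain ⟨hp, hpz⟩ := mem_primesLE_ceil_sub_one.mp hp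
    rw [card_filter_exists_and_dvd_eval_of_forall f hp _ (fun i => hpz.trans_le (hz₀ i))]
  -- the window: `1 − ω(p)/p = Π_p · c_p`
  have hwin : ∏ p ∈ Nat.primesLE x \ Nat.primesLE (⌈z i₀⌉₊ - 1),
      (1 - (((range p).filter (fun r : ℕ => ∃ i,
          (p : ℝ) < z i ∧ (p : ℤ) ∣ (f i).eval (r : ℤ))).card : ℝ) / (p : ℝ)) =
      ∏ p ∈ Nat.primesLE x \ Nat.primesLE (⌈z i₀⌉₊ - 1),
        ((∏ i ∈ univ.filter (fun i => (p : ℝ) < z i),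
            (1 - (polyRootCountMod ![f i] p : ℝ) / p)) *
        ((1 - (((range p).filter (fun r : ℕ => ∃ i,
            (p : ℝ) < z i ∧ (p : ℤ) ∣ (f i).eval (r : ℤ))).card : ℝ) / (p : ℝ)) /
          ∏ i ∈ univ.filter (fun i => (p : ℝ) < z i),
            (1 - (polyRootCountMod ![f i] p : ℝ) / p))) := by
    refine prod_congr rfl fun p hp => ?_
    have hp' : p.Prime := Nat.prime_of_mem_primesLE (Finset.mem_sdiff.mp hp).1
    rw [mul_div_cancel₀]
    exact (prod_pos fun i _ => one_sub_rootCount_single_div_pos hf i hp').ne'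
  -- the double product, re-indexed by `i`
  have hcomm : ∏ p ∈ Nat.primesLE x \ Nat.primesLE (⌈z i₀⌉₊ - 1),
      ∏ i ∈ univ.filter (fun i => (p : ℝ) < z i), (1 - (polyRootCountMod ![f i] p : ℝ) / p) =
      ∏ i, (∏ p ∈ Nat.primesLE (⌈z i⌉₊ - 1), (1 - (polyRootCountMod ![f i] p : ℝ) / p)) /
          ∏ p ∈ Nat.primesLE (⌈z i₀⌉₊ - 1), (1 - (polyRootCountMod ![f i] p : ℝ) / p) := by
    calc ∏ p ∈ Nat.primesLE x \ Nat.primesLE (⌈z i₀⌉₊ - 1),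
          ∏ i ∈ univ.filter (fun i => (p : ℝ) < z i), (1 - (polyRootCountMod ![f i] p : ℝ) / p)
        = ∏ p ∈ Nat.primesLE x \ Nat.primesLE (⌈z i₀⌉₊ - 1),
            ∏ i, (if (p : ℝ) < z i then (1 - (polyRootCountMod ![f i] p : ℝ) / p) else 1) := by
          refine prod_congr rfl fun p _ => ?_
          rw [prod_filter]
      _ = ∏ i, ∏ p ∈ Nat.primesLE x \ Nat.primesLE (⌈z i₀⌉₊ - 1),
            (if (p : ℝ) < z i then (1 - (polyRootCountMod ![f i] p : ℝ) / p) else 1) := prod_comm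
      _ = ∏ i, ∏ p ∈ (Nat.primesLE x \ Nat.primesLE (⌈z i₀⌉₊ - 1)).filter
            (fun p : ℕ => (p : ℝ) < z i), (1 - (polyRootCountMod ![f i] p : ℝ) / p) := by
          refine prod_congr rfl fun i _ => ?_
          rw [prod_filter]
      _ = ∏ i, (∏ p ∈ Nat.primesLE (⌈z i⌉₊ - 1), (1 - (polyRootCountMod ![f i] p : ℝ) / p)) /
            ∏ p ∈ Nat.primesLE (⌈z i₀⌉₊ - 1), (1 - (polyRootCountMod ![f i] p : ℝ) / p) := by
          refine prod_congr rfl fun i _ => ?_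
          rw [filter_lt_primesLE_sdiff z i₀ i (hzx i)]
          refine eq_div_of_mul_eq (prod_pos fun p hp =>
            one_sub_rootCount_single_div_pos hf i (Nat.prime_of_mem_primesLE hp)).ne' ?_
          exact prod_sdiff (hsubi i)
  rw [hwin, prod_mul_distrib, hcomm, hsmall]
  ring

/-- **The correction product is `1 + o(1)`.**  If `ω_f(p) = ∑ᵢ ρᵢ(p)` for every prime `p > m₀`,
then the product over the primes `m₀ < p ≤ x` of the correction factors
`c_p = (1 − ω(p)/p) / ∏_{i : p < zᵢ} (1 − ρᵢ(p)/p)` satisfies `1 − 4D²/(m₀ + 1) ≤ ∏ c_p ≤ 1`,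
`D = ∑ deg fᵢ`: indeed `ω(p) = ∑_{i : p < zᵢ} ρᵢ(p)`, so `0 ≤ 1 − c_p ≤ 2(∑_{i : p < zᵢ} ρᵢ(p)/p)² ≤
2D²/p²` (`ρᵢ(p) ≤ deg fᵢ`), and `∑_{p > m₀} p⁻² ≤ 2/(m₀ + 1)`. [folklore] -/
theorem corr_prod_bounds {k : ℕ} {f : Fin k → ℤ[X]} (hf : IsBatemanHornSystem f) (z : Fin k → ℝ)
    (m₀ x : ℕ)
    (hsum : ∀ p : ℕ, p.Prime → m₀ < p → polyRootCountMod f p = ∑ i, polyRootCountMod ![f i] p) :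
    1 - 4 * (((∑ i, (f i).natDegree : ℕ) : ℝ)) ^ 2 / ((m₀ : ℝ) + 1) ≤
      ∏ p ∈ Nat.primesLE x \ Nat.primesLE m₀,
        ((1 - (((range p).filter (fun r : ℕ => ∃ i,
            (p : ℝ) < z i ∧ (p : ℤ) ∣ (f i).eval (r : ℤ))).card : ℝ) / (p : ℝ)) /
          ∏ i ∈ univ.filter (fun i => (p : ℝ) < z i),
            (1 - (polyRootCountMod ![f i] p : ℝ) / p)) ∧
    ∏ p ∈ Nat.primesLE x \ Nat.primesLE m₀,
        ((1 - (((range p).filter (fun r : ℕ => ∃ i,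
            (p : ℝ) < z i ∧ (p : ℤ) ∣ (f i).eval (r : ℤ))).card : ℝ) / (p : ℝ)) /
          ∏ i ∈ univ.filter (fun i => (p : ℝ) < z i),
            (1 - (polyRootCountMod ![f i] p : ℝ) / p)) ≤ 1 := by
  have hmem : ∀ p ∈ Nat.primesLE x \ Nat.primesLE m₀, p.Prime ∧ m₀ < p ∧ p ≤ x := by
    intro p hp
    rw [Finset.mem_sdiff, Nat.mem_primesLE, Nat.mem_primesLE] at hp
    obtain ⟨⟨hpx, hp⟩, hnot⟩ := hp
    exact ⟨hp, by by_contra h; exact hnot ⟨not_lt.mp h, hp⟩, hpx⟩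
  have hWsub : Nat.primesLE x \ Nat.primesLE m₀ ⊆ Ioo m₀ (x + 1) := by
    intro p hp
    obtain ⟨-, hm₀p, hpx⟩ := hmem p hp
    exact mem_Ioo.mpr ⟨hm₀p, Nat.lt_succ_of_le hpx⟩
  have h := prod_bounds_of_factor_bounds hWsub
    (fun p : ℕ => (1 - (((range p).filter (fun r : ℕ => ∃ i,
        (p : ℝ) < z i ∧ (p : ℤ) ∣ (f i).eval (r : ℤ))).card : ℝ) / (p : ℝ)) /
      ∏ i ∈ univ.filter (fun i => (p : ℝ) < z i), (1 - (polyRootCountMod ![f i] p : ℝ) / p))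
    (B := 2 * (((∑ i, (f i).natDegree : ℕ) : ℝ)) ^ 2) (by positivity) fun p hp => by
      obtain ⟨hp', hm₀p, -⟩ := hmem p hp
      exact corr_factor_bounds hp'.pos _ _ _ (fun i _ => rootCount_single_lt hf i hp')
        (fun i => rootCount_single_le_natDegree hf i hp')
        (card_filter_exists_and_dvd_eval_eq_sum f hp' (hsum p hp' hm₀p) _)
        ((card_filter_le _ _).trans (card_range p).le)
  rw [show 2 * (2 * (((∑ i, (f i).natDegree : ℕ) : ℝ)) ^ 2) / ((m₀ : ℝ) + 1) =
      4 * (((∑ i, (f i).natDegree : ℕ) : ℝ)) ^ 2 / ((m₀ : ℝ) + 1) by ring] at h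
  exact h

end BatemanHornMertens

end Literature.NumberTheory.Sieve

end
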